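import Mathlib
import Literature.Analysis.Convexity.AnisotropicPerimeter
import HarnessLib

/-!
# The divergence of a field on `EuclideanSpace ℝ (Fin n)` in coordinates `Fin n → ℝ`

Topic `Literature/MeasureTheory/Integral`; namespace `Literature.MeasureTheory.Integral`.
Bridge between the tree's `fieldDivergence φ x = tr Dφ(x)` (used by `perimeter` /
`anisotropicPerimeter`, `EuclideanSpace ℝ (Fin n)`) and the coordinate form used by the Gauss–Green
bricks of this topic (`HPolytopeGaussGreen`: fields given by components `η_i : (Fin 3 → ℝ) → ℝ` with
partials `HasDerivAt (fun s => η_i (update x i s)) (dη_i x) (x i)`):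
* `fieldDivergence_eq_sum` — `div φ (x) = Σ_i (Dφ(x) eᵢ)ᵢ` (any `φ`; standard frame);
* `hasDerivAt_apply_toLp_update` — for `C¹` `φ`, the `i`-th component of `φ ∘ toLp` along the `i`-th
  coordinate line has derivative `(Dφ(toLp x) eᵢ)ᵢ`;
* `continuous_apply_toLp`, `continuous_fderiv_apply_toLp` — continuity of these components/partials;
* `setIntegral_toLp_preimage` — `∫_{S} f = ∫_{toLp ⁻¹' S} f ∘ toLp` (volume preserving).
[cite: EvansGariepy2015, §5.1 (div φ) and Thm 5.16 — plumbing]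
-/

noncomputable section

namespace Literature.MeasureTheory.Integral

open _root_.MeasureTheory Set
open Literature.MathematicalPhysics.StatisticalMechanics (fieldDivergence)

variable {n : ℕ}

/-- `div φ (x) = Σ_i (Dφ(x) eᵢ)ᵢ` in the standard frame of `EuclideanSpace ℝ (Fin n)`.
[cite: EvansGariepy2015, §5.1 (div φ)] -/
theorem fieldDivergence_eq_sum (φ : EuclideanSpace ℝ (Fin n) → EuclideanSpace ℝ (Fin n))
    (x : EuclideanSpace ℝ (Fin n)) :
    fieldDivergence φ x = ∑ i, (fderiv ℝ φ x (EuclideanSpace.single i 1)) i := by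
  unfold fieldDivergence
  rw [LinearMap.trace_eq_matrix_trace ℝ (EuclideanSpace.basisFun (Fin n) ℝ).toBasis, Matrix.trace]
  refine Finset.sum_congr rfl fun i _ => ?_
  rw [Matrix.diag_apply, LinearMap.toMatrix_apply]
  simp

/-- The coordinate line through `toLp x` in direction `i`. [cite: EvansGariepy2015, Thm 5.16 — plumbing] -/
theorem toLp_update_eq (x : Fin n → ℝ) (i : Fin n) (s : ℝ) :
    (WithLp.toLp 2 (Function.update x i s) : EuclideanSpace ℝ (Fin n)) =
      WithLp.toLp 2 x + (s - x i) • EuclideanSpace.single i 1 := by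
  ext l
  by_cases hl : l = i
  · subst hl; simp
  · simp [hl]

/-- For `C¹` `φ`, the `i`-th component along the `i`-th coordinate line:
`d/ds (φ(toLp (update x i s)))ᵢ |_{s = xᵢ} = (Dφ(toLp x) eᵢ)ᵢ`.
[cite: EvansGariepy2015, Thm 5.16 — plumbing] -/
theorem hasDerivAt_apply_toLp_update {φ : EuclideanSpace ℝ (Fin n) → EuclideanSpace ℝ (Fin n)}
    (hφ : ContDiff ℝ 1 φ) (i : Fin n) (x : Fin n → ℝ) :
    HasDerivAt (fun s => (φ (WithLp.toLp 2 (Function.update x i s))) i)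
      ((fderiv ℝ φ (WithLp.toLp 2 x) (EuclideanSpace.single i 1)) i) (x i) := by
  have h1 : HasDerivAt (fun s : ℝ => (WithLp.toLp 2 x : EuclideanSpace ℝ (Fin n)) +
      (s - x i) • EuclideanSpace.single i 1) (EuclideanSpace.single i (1:ℝ)) (x i) := by
    have := ((hasDerivAt_id (x i)).sub_const (x i)).smul_const (EuclideanSpace.single i (1:ℝ))
    simpa using this.const_add (WithLp.toLp 2 x)
  have h2 : HasFDerivAt φ (fderiv ℝ φ (WithLp.toLp 2 x))
      (WithLp.toLp 2 x + (x i - x i) • EuclideanSpace.single i 1) := by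
    rw [sub_self, zero_smul, add_zero]
    exact (hφ.differentiable one_ne_zero _).hasFDerivAt
  have h3 := h2.comp_hasDerivAt (x i) h1
  have h4 := (EuclideanSpace.proj i : EuclideanSpace ℝ (Fin n) →L[ℝ] ℝ).hasFDerivAt.comp_hasDerivAt
    (x i) h3
  have hfun : (fun s => (φ (WithLp.toLp 2 (Function.update x i s))) i) =
      fun s => (EuclideanSpace.proj i : EuclideanSpace ℝ (Fin n) →L[ℝ] ℝ)
        ((φ ∘ fun s => (WithLp.toLp 2 x : EuclideanSpace ℝ (Fin n)) +
          (s - x i) • EuclideanSpace.single i 1) s) := by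
    funext s; simp only [Function.comp_def]; rw [toLp_update_eq x i s]; rfl
  rw [hfun]; exact h4

/-- Continuity of a component of `φ ∘ toLp`. [cite: EvansGariepy2015, Thm 5.16 — plumbing] -/
theorem continuous_apply_toLp {φ : EuclideanSpace ℝ (Fin n) → EuclideanSpace ℝ (Fin n)}
    (hφ : Continuous φ) (i : Fin n) : Continuous fun x : Fin n → ℝ => (φ (WithLp.toLp 2 x)) i :=
  (PiLp.continuous_apply 2 _ i).comp (hφ.comp (PiLp.continuous_toLp 2 _))

/-- Continuity of the coordinate partials of a `C¹` field. [cite: EvansGariepy2015, Thm 5.16 — plumbing] -/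
theorem continuous_fderiv_apply_toLp {φ : EuclideanSpace ℝ (Fin n) → EuclideanSpace ℝ (Fin n)}
    (hφ : ContDiff ℝ 1 φ) (i : Fin n) :
    Continuous fun x : Fin n → ℝ => (fderiv ℝ φ (WithLp.toLp 2 x) (EuclideanSpace.single i 1)) i := by
  have hc : Continuous (fderiv ℝ φ) := hφ.continuous_fderiv one_ne_zero
  have h2 : Continuous fun z : EuclideanSpace ℝ (Fin n) =>
      fderiv ℝ φ z (EuclideanSpace.single i 1) := hc.clm_apply continuous_const
  exact (PiLp.continuous_apply 2 _ i).comp (h2.comp (PiLp.continuous_toLp 2 _))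

/-- Set integrals transfer along `toLp : (Fin n → ℝ) → EuclideanSpace ℝ (Fin n)` (volume preserving).
[cite: EvansGariepy2015, Thm 5.16 — plumbing] -/
theorem setIntegral_eq_setIntegral_preimage_toLp (f : EuclideanSpace ℝ (Fin n) → ℝ)
    (S : Set (EuclideanSpace ℝ (Fin n))) :
    ∫ z in S, f z = ∫ x in (WithLp.toLp 2) ⁻¹' S, f (WithLp.toLp 2 x) := by
  rw [(PiLp.volume_preserving_toLp (Fin n)).setIntegral_preimage_emb
    (MeasurableEquiv.toLp 2 (Fin n → ℝ)).measurableEmbedding]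

/-- The divergence integral of a field over a set, in coordinates: `∫_S div φ = ∫_{toLp⁻¹ S} Σ_i ∂_i φ_i`.
[cite: EvansGariepy2015, Thm 5.16 — plumbing] -/
theorem setIntegral_fieldDivergence_eq_coords (φ : EuclideanSpace ℝ (Fin n) → EuclideanSpace ℝ (Fin n))
    (S : Set (EuclideanSpace ℝ (Fin n))) :
    ∫ z in S, fieldDivergence φ z =
      ∫ x in (WithLp.toLp 2) ⁻¹' S,
        ∑ i, (fderiv ℝ φ (WithLp.toLp 2 x) (EuclideanSpace.single i 1)) i := by
  rw [setIntegral_eq_setIntegral_preimage_toLp]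
  congr 1
  funext x
  exact fieldDivergence_eq_sum φ _

end Literature.MeasureTheory.Integral

end
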